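import Mathlib
import Summits.NavierStokesRegularity.NavierStokesRegularity.Theorems.TaoLadderRungTwoFlatBehindBlockExport
import Summits.NavierStokesRegularity.NavierStokesRegularity.Theorems.TaoLadderRungTwoFlatBehindApriori
import HarnessLib

/-!
# IN-HOP WINDOW DEVIATION AT GOOD TIMES, generic slot — the tube-level export of the second output of the joint a-priori loop
  (`|(S − W_z)_{i,m}(s)| ≤ A` on the near window `m ∈ [−D, 1−K]`), companion of `behindBlockEnergies_of_schedule_slot`
  (helper for the K_A♭ parent item stmt-NavierStokesRegularity-22987 `FlatGapCertificatesV2`, child 2A `GradedAdiabaticWakeA` of route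
  TaoLadderRungTwoFlat; cell harvest/h2-tao-ladder, p1 g25; LADDER §54–§61, K4 zone levels (A-133))

`R54.near_behind_apriori_of_pseudoFlows_iface` returns four in-hop outputs along a premise flow up to the induction horizon: clock-weighted behind
amplitudes, the WINDOW deviation `|(S − W)| ≤ A` on `[−D, 1−K]`, the near co-moving energy, and the edge amplitude. `…BehindBlockExport` exported the
behind block energies at tube level; this module exports the window deviation with the SAME hypothesis list (so the plain window levels
`|S_{i,m}| ≤ M + A`, `m ∈ [−D, 1−K]`, of the K4 zone-level input `hlev` follow from the template bound `M`).

* `windowDeviation_of_schedule_slot`.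

HONEST FRAMING: composition over the cell's typed induction frame (MODEL lattice, graded mirror table on `S♭`); rows are HYPOTHESES; nothing
certified; no item closed; nothing about the Navier–Stokes equations.
-/

noncomputable section

-- the sub-problem namespace repeats the summit name by design (D-0017)
set_option linter.dupNamespace false

namespace Summit.NavierStokesRegularity.NavierStokesRegularity.Theorems.HopTube

open Set Finset Literature.Analysis.FluidPDE Literature.Analysis.FluidPDE.TaoCascade MirrorPulse GappedFrontRobustOn

section Export

variable {ε ε₀ : ℝ}

set_option maxHeartbeats 400000 in
/-- **IN-HOP WINDOW DEVIATION AT GOOD TIMES, generic slot**: along every premise of hop `n > N₀` (slot `Bcl → behindR54`) and at every good time `t`,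
for all `s ∈ [0, t]`, `|(S − W_z)_{i,m}(s)| ≤ A` on `m ∈ [−D, 1−K]` (`A = √(2V̄_B)e^{θ′/2}e^{θ′(D−K)/2} + M`). Hypotheses as
`behindBlockEnergies_of_schedule_slot`. [cite: Tao2016AveragedNS, §4 (4.1), (4.3), (4.5), (4.8), §6.3–6.4 (statement shape); route TaoLadderRungTwoFlat, joint a-priori loop (cell LADDER §54–§61)] -/
theorem windowDeviation_of_schedule_slot (P : TubeSchedule) {θ' : ℝ} {Wb : ℕ → ℝ} {i₀ : Fin 2}
    {Bcl : ℕ → (Fin 2 → ℤ → ℝ) → Prop} (hBcl : ∀ m z, Bcl m z → behindR54 P θ' Wb m z)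
    {X₀ : Fin 2 → ℝ} {w : ℤ → ℝ} {r c₀ : ℝ} {ζ : ℕ → Fin 2 → ℤ → ℝ} {ustar : Fin 2 → ℤ → ℝ}
    {good : ℕ → (Fin 2 → ℤ → ℝ → ℝ) → ℝ → Prop} {n : ℕ}
    {cW κ₂ : ℝ} {W₀ FW₀ BW₀ : (Fin 2 → ℤ → ℝ) → Fin 2 → ℤ → ℝ} {W FW : (Fin 2 → ℤ → ℝ) → Fin 2 → ℤ → ℝ → ℝ}
    (hWflow : ∀ z, InTubeWith P Bcl i₀ X₀ w r ζ ustar n z →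
      PseudoFlowOnShift shiftSetFlat cW ε₀ (mirrorTable ε ε) 0 κ₂ (W₀ z) (FW₀ z) (BW₀ z) (W z) (FW z)) (hcW : c₀ ≤ cW)
    (hε : 0 ≤ ε) (hε₀ : 0 < ε₀) (hn : P.N₀ < n) (hK : 1 ≤ P.K) (hDK : P.K + 1 ≤ P.D) (hθV : 0 < P.θV)
    (hθ : 0 < θ') (hθ5 : θ' ≤ 5 * Real.log (1 + ε₀)) (hw1 : ∀ k, 1 ≤ w k) (hr0 : 0 ≤ r)
    (hAstar : 0 < P.Astar) {ωK MuK : ℝ} (hωK : 0 < ωK)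
    (hωKle : ∀ i, ωK ≤ MirrorPulse.geomGauge P.g P.b i (-(P.K : ℤ))) (hMuK : ∀ i, |ustar i (-(P.K : ℤ))| ≤ MuK)
    (hWbn : 0 ≤ Wb n)
    {tlo : ℝ} (htlo : 0 < tlo)
    (hwin : ∀ z S₀ τ S F, HopPremiseWith P Bcl shiftSetFlat ε₀ i₀ (mirrorTable ε ε) X₀ w r c₀ ζ
      ustar n z S₀ τ S F → ∀ t, good n S t → tlo ≤ t ∧ t ≤ c₀)
    {Aeff A A₀ A₁ M M₁ M₂ rI RBAR BBAR RHO2 rs I₁ I₂ PUMP μN μB VbarN VbarB EW V₀N V₀B EN : ℝ}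
    (hAeff : 0 < Aeff) (hM0 : 0 ≤ M)
    (hM : ∀ z, InTubeWith P Bcl i₀ X₀ w r ζ ustar n z →
      ∀ s ∈ Icc 0 c₀, ∀ i, ∀ m ∈ Finset.Icc (-(P.D : ℤ)) (1 - (P.K : ℤ)), |W z i m s| ≤ M)
    (hM₁ : ∀ z, InTubeWith P Bcl i₀ X₀ w r ζ ustar n z → ∀ s ∈ Icc 0 c₀, |W z 1 (-(P.K : ℤ)) s| ≤ M₁)
    (hM₂0 : 0 ≤ M₂)
    (hM₂ : ∀ z, InTubeWith P Bcl i₀ X₀ w r ζ ustar n z → ∀ s ∈ Icc 0 c₀, |W z 0 (2 - (P.K : ℤ)) s| ≤ M₂)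
    (hEW : ∀ z, InTubeWith P Bcl i₀ X₀ w r ζ ustar n z →
      coMovingEnergyOn (Finset.Icc (1 - (P.D : ℤ)) (-(P.K : ℤ))) P.θV (-(P.K : ℝ))
        (fun i k _ => anchorScale P i₀ z * ustar i k - W₀ z i k) 0 ≤ EW)
    -- section datum at the interface shell and the deeper core input (the only in-hop core data)
    (hsec : ∀ z S₀ τ S F, HopPremiseWith P Bcl shiftSetFlat ε₀ i₀ (mirrorTable ε ε) X₀ w r c₀ ζ
      ustar n z S₀ τ S F → ∀ i, |(S - W z) i (1 - (P.K : ℤ)) 0| ≤ rs)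
    (hρ0 : 0 ≤ RHO2)
    (hcore2 : ∀ z S₀ τ S F, HopPremiseWith P Bcl shiftSetFlat ε₀ i₀ (mirrorTable ε ε) X₀ w r c₀ ζ
      ustar n z S₀ τ S F → ∀ t, good n S t → ∀ s ∈ Icc 0 t, |(S - W z) 0 (2 - (P.K : ℤ)) s| ≤ RHO2)
    -- interface levels (L-61a/L-61b) and link facts
    (hRB0 : 0 ≤ RBAR) (hBB0 : 0 ≤ BBAR) (hRr : RBAR ≤ rI) (hBr : BBAR ≤ rI) (hVN0 : 0 ≤ VbarN)
    (hI₁0 : 0 ≤ I₁) (hI₂0 : 0 ≤ I₂)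
    (hI₁ : 2 * (Real.exp (P.θV / 2) - 1) ≤ I₁ * P.θV) (hI₂ : Real.exp P.θV - 1 ≤ I₂ * P.θV)
    (hPUMPdef : PUMP = 1 * c₀ * ((2 + ε) * M * I₁ * Real.sqrt (2 * VbarN) + 2 * I₂ * VbarN))
    (hlevC : rs + PUMP + 1 * c₀ * ((ε * (M + I₁ * Real.sqrt (2 * VbarN)) + ε * M + ε * BBAR) * RBAR
      + (2 + ε) * M * BBAR + BBAR ^ 2) < RBAR)
    (hlevV : rs + 1 * c₀ * ((M + M₂ + RBAR + RHO2) * BBAR + (1 + 2 * ε) * M * RBAR + ε * RBAR ^ 2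
      + (M + 2 * ε * M₂) * RHO2 + ε * RHO2 ^ 2) < BBAR)
    -- near/behind schedule (window forms)
    (hAdef : A = Real.sqrt (2 * VbarB) * Real.exp (θ' / 2) * Real.exp (θ' * ((P.D : ℝ) - P.K) / 2) + M)
    (hA₀def : A₀ = M + rI) (hA₁def : A₁ = M₁ + Real.sqrt (2 * VbarN) * Real.exp (P.θV / 2))
    (hrA : rI ≤ A) (hA₀le : A₀ ≤ Aeff)
    (hV₀Ndef : V₀N = (Real.sqrt (P.v n + (P.δ n / ωK) ^ 2) + Real.sqrt P.D * r + Real.sqrt EW) ^ 2)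
    (hV₀Bdef : V₀B = (Real.sqrt (Wb n + (MuK + P.δ n / ωK) ^ 2) + r / Real.sqrt (1 - Real.exp (-θ'))) ^ 2)
    (hENdef : EN = Real.exp (P.θV * ((1 : ℝ) - P.D + P.K)) * ((1 + ε) * 1 * A ^ 2 * (A + M))
      + 1 * rI * (2 * VbarN + ε * rI * Real.sqrt (2 * VbarN) + (1 + ε) * M * rI))
    (hμN : 0 < μN)
    (hμNle : μN ≤ (1 / c₀) * P.θV - 2 * (1 + ε) * 1 * (A * Real.sinh (P.θV / 2) + M * (3 + Real.exp P.θV)))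
    (hμB : 0 < μB) (hμBle : μB ≤ (1 / c₀) * θ' - 2 * (1 + ε) * Aeff * Real.sinh (θ' / 2))
    (hlevN : V₀N + EN * c₀ < VbarN) (hlevB : V₀B + A₁ * A₀ * (A₁ + ε * A₀) * c₀ < VbarB)
    (hclose : Real.sqrt (2 * VbarB) * Real.exp (θ' / 2) ≤ Aeff) :
    ∀ z S₀ τ S F, HopPremiseWith P Bcl shiftSetFlat ε₀ i₀ (mirrorTable ε ε) X₀ w r c₀ ζ ustar n z S₀ τ S F →
      ∀ t, good n S t → ∀ s ∈ Icc 0 t, ∀ (i : Fin 2), ∀ m ∈ Finset.Icc (-(P.D : ℤ)) (1 - (P.K : ℤ)), |(S - W z) i m s| ≤ A := by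
  have hε₀' : (-1 : ℝ) < ε₀ := by linarith
  have hrI0 : 0 ≤ rI := hRB0.trans hRr
  have hA0 : 0 ≤ A := hrI0.trans hrA
  have hEN0 : 0 ≤ EN := by rw [hENdef]; positivity
  have hwin' : ∀ z S₀ τ S F, HopPremiseWith P Bcl shiftSetFlat ε₀ i₀ (mirrorTable ε ε) X₀ w r c₀ ζ
      ustar n z S₀ τ S F → ∀ t, good n S t → 0 < t ∧ t ≤ c₀ := fun z S₀ τ S F h t ht =>
    ⟨htlo.trans_le (hwin z S₀ τ S F h t ht).1, (hwin z S₀ τ S F h t ht).2⟩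
  -- the interface levels at good times (the loop of record)
  have hlev := interfaceLevels_of_schedule_slot P hBcl hWflow hcW hε hε₀ hn hK hDK hθV hθ hθ5 hw1 hr0 hAstar hωK hωKle
    hMuK hWbn hwin' hAeff hM0 hM hM₁ hM₂0 hM₂ hEW hsec hρ0 hcore2 hRB0 hBB0 hRr hBr hVN0 hI₁0 hI₂0 hI₁ hI₂ hPUMPdef
    hlevC hlevV hAdef hA₀def hA₁def hrA hA₀le hV₀Ndef hV₀Bdef hENdef hμN hμNle hμB hμBle hlevN hlevB hclose
  intro z S₀ τf S F hprem t hgood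
  obtain ⟨htlo_t, htc₀⟩ := hwin z S₀ τf S F hprem t hgood
  have htpos : 0 < t := htlo.trans_le htlo_t
  -- the interface level `rI` on `[0, t]` (both species)
  have hcore_t : ∀ s ∈ Icc 0 t, ∀ i, |(S - W z) i (1 - (P.K : ℤ)) s| ≤ rI := by
    intro s hs i
    obtain ⟨h0, h1⟩ := hlev z S₀ τf S F hprem t hgood s hs
    fin_cases i
    · exact h0.trans hRr
    · exact h1.trans hBr
  obtain ⟨hz, hkick, hc₀τ, hflow⟩ := hprem
  -- the clauses of `H(n)` (tube phase)
  have hzW : InTubeWith P Bcl i₀ X₀ w r ζ ustar n z := hz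
  have h0 : n ≠ 0 := by omega
  have h1 : ¬ n ≤ P.N₀ := by omega
  simp only [InTubeWith, h0, if_false, h1] at hz
  obtain ⟨hanch, hcoreCl, hnearCl, hbeh', -⟩ := hz
  have hbeh := hBcl n z hbeh'
  have hWz := hWflow z hzW
  -- restrict both flows to `[0, t]`
  have hS' := pseudoFlowOnShift_mono hflow htpos (htc₀.trans hc₀τ)
  have hW' := pseudoFlowOnShift_mono hWz htpos (htc₀.trans hcW)
  -- the kick, everywhere (weights `≥ 1`)
  have hkick' : ∀ i k, |S₀ i k - z i k| ≤ r := by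
    intro i k
    calc |S₀ i k - z i k| = 1 * |S₀ i k - z i k| := (one_mul _).symm
      _ ≤ w k * |S₀ i k - z i k| := mul_le_mul_of_nonneg_right (hw1 k) (abs_nonneg _)
      _ ≤ r := hkick i k
  -- the STARTS from `H(n)`
  have hstartN : coMovingEnergyOn (Finset.Icc (1 - (P.D : ℤ)) (-(P.K : ℤ))) P.θV (-(P.K : ℝ)) (S - W z) 0 ≤ V₀N := by
    have h := sqrt_initial_coMovingEnergyOn_le_additive P hflow.init_S hWz.init_S hθV.le hDK hnearCl hcoreCl hωK
      hωKle (fun i k _ => hkick' i k) hr0 (hEW z hzW)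
    have hnn : 0 ≤ coMovingEnergyOn (Finset.Icc (1 - (P.D : ℤ)) (-(P.K : ℤ))) P.θV (-(P.K : ℝ)) (S - W z) 0 :=
      coMovingEnergyOn_nonneg _ _ _ _ _
    rw [hV₀Ndef]
    calc coMovingEnergyOn (Finset.Icc (1 - (P.D : ℤ)) (-(P.K : ℤ))) P.θV (-(P.K : ℝ)) (S - W z) 0
        = Real.sqrt (coMovingEnergyOn (Finset.Icc (1 - (P.D : ℤ)) (-(P.K : ℤ))) P.θV (-(P.K : ℝ)) (S - W z) 0) ^ 2 :=
          (Real.sq_sqrt hnn).symm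
      _ ≤ _ := pow_le_pow_left₀ (Real.sqrt_nonneg _) h 2
  have haK : ∀ i, |z i (-(P.K : ℤ))| ≤ MuK + P.δ n / ωK := fun i =>
    abs_windowBottom_le_of_clauses P hAstar hanch hcoreCl hωK hωKle hMuK i
  have hstartB : ∀ L : ℕ, coMovingEnergyOn (Finset.Icc (1 - (P.K : ℤ) - L) (-(P.K : ℤ))) θ' (-(P.K : ℝ)) S 0
      ≤ V₀B := by
    intro L
    rw [hV₀Bdef]
    exact R54.initial_blockEnergy_le_additive hflow.init_S hθ hbeh.1 hWbn haK
      (fun i k hk => hkick' i k) hr0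
  -- rates and levels at this `t ≤ c₀`
  have h1t : 1 / c₀ ≤ 1 / t := one_div_le_one_div_of_le htpos htc₀
  have hμNle' : μN ≤ (1 / t) * P.θV - 2 * (1 + ε) * 1 * (A * Real.sinh (P.θV / 2) + M * (3 + Real.exp P.θV)) := by
    have h2 := mul_le_mul_of_nonneg_right h1t hθV.le
    linarith only [h2, hμNle]
  have hμBle' : μB ≤ (1 / t) * θ' - 2 * (1 + ε) * Aeff * Real.sinh (θ' / 2) := by
    have h2 := mul_le_mul_of_nonneg_right h1t hθ.le
    linarith only [h2, hμBle]
  have hlevN' : V₀N + EN * t < VbarN := by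
    have h2 := mul_le_mul_of_nonneg_left htc₀ hEN0
    linarith only [h2, hlevN]
  have hA₁0 : 0 ≤ A₁ := by
    rw [hA₁def]
    have hM₁0 : 0 ≤ M₁ := (abs_nonneg _).trans (hM₁ z hzW 0 ⟨le_rfl, htpos.le.trans htc₀⟩)
    exact add_nonneg hM₁0 (mul_nonneg (Real.sqrt_nonneg _) (Real.exp_pos _).le)
  have hA₀0 : 0 ≤ A₀ := by rw [hA₀def]; exact add_nonneg hM0 hrI0
  have hEtop0 : 0 ≤ A₁ * A₀ * (A₁ + ε * A₀) :=
    mul_nonneg (mul_nonneg hA₁0 hA₀0) (add_nonneg hA₁0 (mul_nonneg hε hA₀0))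
  have hlevB' : V₀B + A₁ * A₀ * (A₁ + ε * A₀) * t < VbarB := by
    have h2 := mul_le_mul_of_nonneg_left htc₀ hEtop0
    linarith only [h2, hlevB]
  have hστ : (1 / t) * t = 1 := by rw [one_div, inv_mul_cancel₀ (ne_of_gt htpos)]
  -- the joint a-priori loop on `[0, t]`, then the behind block energies during the hop
  rw [hENdef] at hlevN'
  obtain ⟨-, hdev, -, -⟩ := R54.near_behind_apriori_of_pseudoFlows_iface hW' hS' hε hε₀ hDK hθV.le hθ.le hθ5 hAeff htpos
    le_rfl hστ hM0 (fun s hs => hM z hzW s ⟨hs.1, hs.2.trans htc₀⟩) (fun s hs => hM₁ z hzW s ⟨hs.1, hs.2.trans htc₀⟩)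
    hcore_t hrI0 hVN0 hAdef hA₀def hA₁def hrA hA₀le hstartN hstartB hμN hμNle' hμB hμBle' hlevN' hlevB' hclose
  exact hdev

end Export

end Summit.NavierStokesRegularity.NavierStokesRegularity.Theorems.HopTube

end
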